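import Summits.BirchSwinnertonDyer.BirchSwinnertonDyer.Theses.ErratumRoadFive
import Summits.BirchSwinnertonDyer.BirchSwinnertonDyer.Theorems.ErratumRoadFiveNonSurjCornerTwinMuAnCertificateShape
import HarnessLib

/-!
# Route `ErratumRoadFive`, crux 19065 `NonSurjCorner`, child 19948 `NonSurjCornerTwinMuAn`: the certificate-shape theorems
# read from the ROUTE's OWN fact bundle `KatoTwinFactsFiveAn` (item 19949) — no free named-fact binders
# (cell `bsd-stepL`, seat `bsd-stepL-corner5-p2` g7; `--supports 19948 --as helper`)

The shape theorems of `…TwinMuAnIndexParity` (p587429), `…TwinMuAnSplitIndexAnyCarrier` (p587950) and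
`…TwinMuAnCertificateShape` (p588611) carry the published inputs as BY-NAME hypotheses: modularity
`exists_isNewformOf`, GZK `rank_eq_analyticRank_of_analyticRank_le_one`, Greenberg–Stevens `greenberg_stevens`, Wuthrich 2014
Cor. 18 `corollary18_padicLFunction_mem_iwasawaAlgebra_multiplicative`. All four are CONJUNCTS (nos. 6, 4, 14, 22) of the
route's support item `Theses.ErratumRoadFive.KatoTwinFactsFiveAn` (19949, the one fact bundle of the `NonSurjCorner` split,
consumed by the registered glue `NonSurjCornerGlue`). This file re-keys the two END statements to that single route constant,
so that a consumer inside the route (the glue's holder of `KatoTwinFactsFiveAn`) reads them with no further input than the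
stub binders and the per-twin numeric datum `shaAn Wd = q` (`q ≠ 0`, `ord_p q ≥ 0`):

* `NonSurjTwin.find_nonsplit_shape_of_katoTwinFacts` — non-split twin: the least witness `n₀` of `stub_twinMuAn_nonsplit`'s
  `∃ n` is `0 ⟺ (ord_p #Ш_an(Wd) = 0 ∧ no split multiplicative place)`, otherwise even `≥ 2`;
* `NonSurjTwin.three_le_find_of_split_of_katoTwinFacts` — split twin: `n₀` is odd and `≥ 3`.

HONEST FRAMING: theorems only (no definition, no named fact, no `sorry`); `KatoTwinFactsFiveAn` is an OPEN support item
(a conjunction of 23 published facts, «never 'proved'» per its docstring) taken as a hypothesis — the statements are exactly as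
conditional as before, only keyed to the route's vocabulary; nothing closes (T7); BSD is proved for no class.
References: route file `Theses/ErratumRoadFive.lean` (items 19948, 19949); [MazurTateTeitelbaum1986Invent] §I.10, §I.15, §I.17–18;
[Wuthrich2014] Cor. 18; [GreenbergStevens1993] Thm. 7.1; [GrossZagier1986] / [Kolyvagin1990] (GZK).
-/

set_option autoImplicit false
set_option linter.dupNamespace false

noncomputable section

open scoped Classical NumberField MatrixGroups ModularForm

namespace Summit.BirchSwinnertonDyer.BirchSwinnertonDyer.Theorems.TatePow

open CongruenceSubgroup PowerSeries WeierstrassCurve IsDedekindDomain Rat.HeightOneSpectrum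
  Literature.NumberTheory.EllipticCurves Literature.NumberTheory.EllipticCurves.ModularForms
  Literature.NumberTheory.EllipticCurves.Rank1Residual Summit.BirchSwinnertonDyer.Rank1Residual
  Summit.BirchSwinnertonDyer.BirchSwinnertonDyer.Theses.ErratumRoadFive

variable {W : WeierstrassCurve ℚ} [W.IsElliptic] [W.IsGloballyMinimal] {p : ℕ} [Fact p.Prime]
  {N : ℕ} [NeZero N] {f : CuspForm (Gamma0 N) 2}

/-- **Non-split corner twin, read from `KatoTwinFactsFiveAn`** (19949; conjuncts used: GZK (4), modularity (6),
Wuthrich Cor. 18 (22)): under the binders of `stub_twinMuAn_nonsplit` and `shaAn Wd = q`, `q ≠ 0`, `ord_p q ≥ 0`, the least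
witness of the stub's `∃ n` is `0` iff `ord_p q = 0 ∧ Wd` has no split multiplicative place, and otherwise even `≥ 2`.
[cite: MazurTateTeitelbaum1986Invent, §I.10, §I.17 and §I.18] [cite: Wuthrich2014, Cor. 18 (p. 398)] -/
theorem NonSurjTwin.find_nonsplit_shape_of_katoTwinFacts (hF : KatoTwinFactsFiveAn) (hXa : ClassX11a W p)
    (hnsj : ¬ Surj W p) (h57 : p = 5 ∨ p = 7) (hns : ¬ W.HasSplitMultiplicativeReductionAtPrime p)
    (hf : IsNewformOf W f) {ϖ : ℚ} (hϖ : (ϖ : ℝ) * W.realPeriodRat = plusPeriod f) {L : PowerSeries ℚ_[p]}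
    (hL : IsMultPAdicLFunctionOf f p (-1) L) {q : ℚ} (hq : shaAn W = (q : ℂ)) (hq0 : q ≠ 0) (hint : 0 ≤ padicValRat p q)
    (h : ∃ n : ℕ, ‖PowerSeries.coeff n (PowerSeries.C ((ϖ : ℚ) : ℚ_[p]) * L)‖ = 1) :
    (Nat.find h = 0 ↔ (padicValRat p q = 0 ∧ ∀ v : HeightOneSpectrum (𝓞 ℚ), ¬ W.HasSplitMultiplicativeReductionAt v)) ∧
      (Nat.find h ≠ 0 → 2 ≤ Nat.find h ∧ Even (Nat.find h)) := by
  obtain ⟨-, -, -, hGZK, -, hmod, -, -, -, -, -, -, -, -, -, -, -, -, -, -, -, hWu, -⟩ := hF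
  exact NonSurjTwin.find_nonsplit_shape hWu hmod hGZK hXa hnsj h57 hns hf hϖ hL hq hq0 hint h

/-- **Split corner twin, read from `KatoTwinFactsFiveAn`** (19949; conjuncts used: GZK (4), modularity (6), Greenberg–Stevens
(14), Wuthrich Cor. 18 (22)): under the binders of `stub_twinMuAn_split` and `shaAn Wd = q`, `q ≠ 0`, `ord_p q ≥ 0`, the least
witness of the stub's `∃ n` is odd and `≥ 3`. [cite: MazurTateTeitelbaum1986Invent, §I.15, §I.17 and §I.18]
[cite: GreenbergStevens1993, Thm. 7.1] [cite: Wuthrich2014, Cor. 18 (p. 398)] -/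
theorem NonSurjTwin.three_le_find_of_split_of_katoTwinFacts (hF : KatoTwinFactsFiveAn) (hXa : ClassX11a W p)
    (hnsj : ¬ Surj W p) (h57 : p = 5 ∨ p = 7) (hsplit : W.HasSplitMultiplicativeReductionAtPrime p)
    (hf : IsNewformOf W f) {ϖ : ℚ} (hϖ : (ϖ : ℝ) * W.realPeriodRat = plusPeriod f) {L : PowerSeries ℚ_[p]}
    (hL : IsMultPAdicLFunctionOf f p 1 L) {q : ℚ} (hq : shaAn W = (q : ℂ)) (hq0 : q ≠ 0) (hint : 0 ≤ padicValRat p q)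
    (h : ∃ n : ℕ, ‖PowerSeries.coeff n (PowerSeries.C ((ϖ : ℚ) : ℚ_[p]) * L)‖ = 1) :
    3 ≤ Nat.find h ∧ Odd (Nat.find h) := by
  obtain ⟨-, -, -, hGZK, -, hmod, -, -, -, -, -, -, -, hGS, -, -, -, -, -, -, -, hWu, -⟩ := hF
  exact NonSurjTwin.three_le_find_of_split_noDatum hWu hmod hGZK (hGS W p) hXa hnsj h57 hsplit hf hϖ hL hq hq0 hint h

end Summit.BirchSwinnertonDyer.BirchSwinnertonDyer.Theorems.TatePow

end
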